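import Summits.Ventures.PercRepro.C025ProfileThinHallStepsC

/-!
# THE HALL FORM `(H⁺_{q,q+1})` ON EVERY THIN(q) MATROID — part D: the theorem (night-3 g17)
**`hallIneq_thin_all`**: for every `q ≥ 2` and every finite matroid in which every rank-`q` set has at most `q + 1` points — simple or
not — the Hall form `Profile.HallIneq M q (q + 1)` (C-033 at `(q, q+1)`): a thin(q) matroid has at most one defect
(`C025ProfileThinNonSimple`); a loop is the loop step (`hallIneq_of_isLoop`, part A) into g16's `hallIneq_thin_simple_all` on the simple
thin `M ＼ {ℓ}`; a parallel pair `x ∥ y` is the Hall Theorem F (`hallIneq_of_parallel`, part C) on the simple thin(q) `M ＼ {y}` at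
`(q, q+1)` and the simple thin(q − 1) `(M ／ {x}) ＼ {y}` at `(q − 1, q)`, both g16.  `profileIneq_and_hallIneq_thin_all` packages it
with the row (`C025ProfileThinRowStepsB`): the row `(q, q+1)` of (Π) AND its Hall form on every thin(q) matroid, every `q ≥ 2` —
g16's `profileIneq_thin_simple_all` with the simplicity hypothesis removed.  `thin_of_indep_thin` / `hallIneq_thin_all_indep`: thinness
in `M.Indep` / `encard` terms.
No `def`, no `instance`, no notation.  Axioms: standard.
-/
open scoped Matroid
namespace PercRepro
open Set Finset ThmH Staged
namespace ThinGirth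
variable {α : Type} [DecidableEq α] {M : Matroid α} [M.Finite]

/-- The Hall form is trivial when `ρ(E) < q`: every family of rank-`q` sets is empty. -/
theorem hallIneq_of_rkN_lt {q u : ℕ} (h : rkN M (gr M) < q) : Profile.HallIneq M q u := by
  intro 𝒜 h𝒜
  have hempty : 𝒜 = ∅ := by
    rw [Finset.eq_empty_iff_forall_notMem]
    intro B hB
    have hBR := Profile.mem_Rq.1 (h𝒜 hB)
    have h1 : rkN M B ≤ rkN M (gr M) := rkN_mono hBR.1
    have h2 : rkN M B = q := by rw [rkN_eq_iff]; exact hBR.2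
    omega
  rw [hempty, Finset.sum_empty]
  exact Nat.cast_nonneg _

/-- **THE HALL FORM (C-033) AT `(q, q+1)` ON EVERY THIN(q) MATROID, `q ≥ 2`**: every finite matroid in which every rank-`q` set has at
most `q + 1` points — simple or not — satisfies `Profile.HallIneq M q (q + 1)`. -/
theorem hallIneq_thin_all (q : ℕ) (hq : 2 ≤ q)
    (hthin : ∀ X ⊆ gr M, rkN M X = q → X.card ≤ q + 1) : Profile.HallIneq M q (q + 1) := by
  rcases Nat.lt_or_ge (rkN M (gr M)) q with hlt | hE
  · exact hallIneq_of_rkN_lt hlt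
  by_cases hloop : ∃ e, M.IsLoop e
  · obtain ⟨e, he⟩ := hloop
    exact hallIneq_of_isLoop he
      (hallIneq_thin_simple_all q (simple_delete_of_isLoop hq hthin hE he) (thin_delete hthin e))
  have hnl : ∀ x ∈ M.E, M.Indep {x} := by
    intro x hx
    exact Matroid.indep_singleton.2 ((Matroid.not_isLoop_iff hx).1 (fun h => hloop ⟨x, h⟩))
  by_cases hsimple : ∀ T ⊆ M.E, T.encard ≤ 2 → M.Indep T
  · exact hallIneq_thin_simple_all q hsimple hthin
  obtain ⟨e, e', heE, he'E, hne, _, hpar'⟩ := exists_parallel_of_not_simple hnl hsimple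
  obtain ⟨q', rfl⟩ : ∃ q', q = q' + 1 := ⟨q - 1, by omega⟩
  refine hallIneq_of_parallel (hnl e heE) (hnl e' he'E) hne.symm hpar' q' ?_ ?_
  · exact hallIneq_thin_simple_all (q' + 1) (simple_delete_of_parallel hq hthin hE heE hne.symm hpar')
      (thin_delete hthin e')
  · exact hallIneq_thin_simple_all q'
      (simple_contract_delete_of_parallel hq hthin hE (hnl e heE) he'E hne hpar') (thin_contract_delete hthin (hnl e heE))

/-- **THE ROW `(q, q+1)` OF (Π) AND ITS HALL FORM ON EVERY THIN(q) MATROID, `q ≥ 2`** — g16's `profileIneq_thin_simple_all` without the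
simplicity hypothesis. -/
theorem profileIneq_and_hallIneq_thin_all (q : ℕ) (hq : 2 ≤ q)
    (hthin : ∀ X ⊆ gr M, rkN M X = q → X.card ≤ q + 1) :
    Profile.ProfileIneq M q (q + 1) ∧ Profile.HallIneq M q (q + 1) :=
  ⟨profileIneq_thin_all q hq hthin, hallIneq_thin_all q hq hthin⟩

omit [DecidableEq α] in
/-- Thinness from its `M.Indep` / `encard` form: if no set of `q + 2` points has rank `≤ q`, every rank-`q` set has `≤ q + 1` points. -/
theorem thin_of_indep_thin {q : ℕ} (hthin : ∀ T ⊆ M.E, T.encard = (q + 2 : ℕ) → (q + 1 : ℕ∞) ≤ M.eRk T) :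
    ∀ X ⊆ gr M, rkN M X = q → X.card ≤ q + 1 := by
  intro X hXg hXr
  by_contra hc
  push Not at hc
  obtain ⟨Y, hYX, hYc⟩ := Finset.exists_subset_card_eq (show q + 2 ≤ X.card by omega)
  have hYE : (Y : Set α) ⊆ M.E := by
    rw [← coe_gr]
    exact_mod_cast hYX.trans hXg
  have h1 := hthin Y hYE (by rw [Set.encard_coe_eq_coe_finsetCard, hYc])
  have h2 : rkN M Y ≤ rkN M X := rkN_mono hYX
  rw [← coe_rkN] at h1
  have h3 : q + 1 ≤ rkN M Y := by exact_mod_cast h1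
  omega

/-- The Hall form on every thin(q) matroid, thinness in `M.Indep` / `encard` terms. -/
theorem hallIneq_thin_all_indep (q : ℕ) (hq : 2 ≤ q)
    (hthin : ∀ T ⊆ M.E, T.encard = (q + 2 : ℕ) → (q + 1 : ℕ∞) ≤ M.eRk T) : Profile.HallIneq M q (q + 1) :=
  hallIneq_thin_all q hq (thin_of_indep_thin hthin)

end ThinGirth
end PercRepro
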